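import Summits.CriticalPhenomena.SAWScalingLimit.Theorems.SAWRenewalTightnessSurgeryReductionDives
import Literature.Probability.LatticeModels.CellDomainBoundary

/-!
# `SurgeryReduction` (stmt-CriticalPhenomena-4731): traversals of the SAW polyline give disjoint annular in-bridges of the lattice walk

Companion of `SAWRenewalTightnessSurgeryReductionDives.lean` (support for the glue item
`Summit.CriticalPhenomena.SAWScalingLimit.Theses.SAWRenewalTightness.SurgeryReduction`).  The event of
`ShellCrossingBound` is `Curve.HasTraversals k x ρ R` for the mesh-`δ` polyline `γ.walk.toCurve (meshPoint δ)`
of a self-avoiding walk `γ` of `Ω_δ`; the walks counted by `AnnularMassDecay` are lattice-unit "annular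
in-bridges" `ω ∈ SAW.Zd.saws 2 n` from a vertex `u` (start at radius `≥ R`, interior vertices in the open
annulus, endpoint in the inner disc).  Here:

* `toCurve_eq_polyline_map_getVert`, `dist_meshPoint_getVert_succ_le` — the SAW polyline is the polyline
  through the mesh points of `γ(0), …, γ(|γ|)`, with steps of length `≤ δ`;
* `exists_dives_of_hasTraversals_toCurve` — `2j` separate traversals of `D(x; ρ, R)`, `ρ + δ < R − δ`, give `j`
  disjoint dives `a₁ < b₁ < ⋯ < a_j < b_j ≤ |γ|` of the vertex sequence (radius `≥ R − δ` at `aₘ`, `≤ ρ + δ` at `bₘ`);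
* `dist_meshPoint_eq_mul` — lattice units: `dist (δ·w) x = δ · dist (w, x/δ)`;
* `subwalk_mem_saws` — a sub-interval of a self-avoiding walk of `Ω_δ`, translated to start at `0`, is an
  element of `SAW.Zd.saws`;
* `exists_annularBridges_of_hasTraversals` — **the conversion**: `2j` separate traversals give `j` sub-walks of
  `γ` on pairwise disjoint index intervals, each of which, read in lattice units about the centre `x/δ` with
  radii `r = (ρ + δ)/δ`, `R' = (R − δ)/δ`, satisfies literally the filter of `AnnularMassDecay`
  (start vertex at distance `≥ R'`, interior vertices in the open annulus `r < · < R'`, last vertex at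
  distance `≤ r`).

[folklore]
-/

noncomputable section

open Set Metric
open scoped unitInterval
open Literature.Probability.LatticeModels Literature.Probability.RandomPlanarGeometry

namespace Summit.CriticalPhenomena.SAWScalingLimit.Theorems.SurgeryReduction

/-! ### The mesh-`δ` polyline of a SAW of `Ω_δ` -/

section SAW

variable {Ω : Set ℂ} {δ : ℝ} {u v : Site 2}

/-- The vertex list of a walk is the list of its vertices `w(0), …, w(|w|)` (cf.
`PlaneNonIntersection.support_eq_map_getVert`). [folklore] -/
theorem support_eq_map_range_getVert {V : Type*} {G : SimpleGraph V} {a b : V} (w : G.Walk a b) :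
    w.support = (List.range (w.length + 1)).map (fun k => w.getVert k) := by
  apply List.ext_getElem
  · simp [SimpleGraph.Walk.length_support]
  · intro i h1 h2
    simp only [List.getElem_map, List.getElem_range]
    rw [SimpleGraph.Walk.getVert_eq_support_getElem w
      (by rw [SimpleGraph.Walk.length_support] at h1; omega)]

/-- The polyline of a walk of `Ω_δ` is the polyline through the mesh points of its vertices
`w(0), …, w(|w|)`. [folklore] -/
theorem toCurve_eq_polyline_map_getVert (w : (discreteDomainGraph Ω δ).Walk u v) :
    w.toCurve (meshPoint δ) =
      polyline ((List.range (w.length + 1)).map (fun k => meshPoint δ (w.getVert k))) := by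
  rw [SimpleGraph.Walk.toCurve, support_eq_map_range_getVert, List.map_map]
  rfl

/-- Nearest neighbours of `ℤ²` have mesh points at distance `|δ|`. [folklore] -/
theorem dist_meshPoint_of_adj (δ : ℝ) {x y : Site 2} (h : (zdGraph 2).Adj x y) :
    dist (meshPoint δ x) (meshPoint δ y) = |δ| := by
  rw [dist_comm, Complex.dist_eq, Complex.norm_def, Complex.normSq_apply]
  have hsq : ∀ t : ℝ, Real.sqrt (t * t) = |t| := fun t => by rw [← sq, Real.sqrt_sq_eq_abs]
  rcases meshPoint_sub_meshPoint_of_adj δ h with ⟨h0, h1⟩ | ⟨h0, h1⟩ | ⟨h0, h1⟩ | ⟨h0, h1⟩ <;>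
    simp only [h0, h1, mul_zero, add_zero, zero_add, neg_mul_neg, hsq]

/-- Consecutive vertices of a walk of `Ω_δ` (`δ ≥ 0`) have mesh points at distance `≤ δ`. [folklore] -/
theorem dist_meshPoint_getVert_succ_le (hδ : 0 ≤ δ) (w : (discreteDomainGraph Ω δ).Walk u v) :
    ∀ i < w.length, dist (meshPoint δ (w.getVert i)) (meshPoint δ (w.getVert (i + 1))) ≤ δ := by
  intro i hi
  have hadj := w.adj_getVert_succ hi
  rw [dist_meshPoint_of_adj δ (meshGraph_le_zdGraph Ω δ (discreteDomainGraph_le_meshGraph Ω δ hadj)),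
    abs_of_nonneg hδ]

/-- **Traversals of the SAW polyline give disjoint lattice dives.**  If the mesh-`δ` polyline of a
self-avoiding walk `γ` of `Ω_δ` (the curve of `ShellCrossingBound`) has `2j` separate traversals of the shell
`D(x; ρ, R)` with `ρ + δ < R − δ`, then there are vertex indices `a₁ < b₁ < ⋯ < a_j < b_j ≤ |γ|` with the
mesh point of `γ(aₘ)` at distance `≥ R − δ` from `x` and that of `γ(bₘ)` at distance `≤ ρ + δ`; by
`exists_inBridge_of_dive` each `[aₘ, bₘ]` contains an annular in-bridge of `γ` for the radii
`(ρ + δ, R − δ)`, and the `j` bridges are vertex-disjoint sub-walks (disjoint index intervals of a path).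
[folklore] -/
theorem exists_dives_of_hasTraversals_toCurve (hδ : 0 ≤ δ) (γ : SAW.DomainSAW Ω δ u v) {x : ℂ}
    {ρ R : ℝ} (hρR : ρ + δ < R - δ) {j : ℕ}
    (h : (⟨γ.walk.toCurve (meshPoint δ)⟩ : Curve ℂ).HasTraversals (2 * j) x ρ R) :
    ∃ a b : Fin j → ℕ, (∀ m, a m < b m) ∧ (∀ m, b m ≤ γ.length) ∧
      (∀ ⦃m m' : Fin j⦄, m < m' → b m < a m') ∧
      (∀ m, R - δ ≤ dist (meshPoint δ (γ.walk.getVert (a m))) x) ∧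
      (∀ m, dist (meshPoint δ (γ.walk.getVert (b m))) x ≤ ρ + δ) := by
  rw [toCurve_eq_polyline_map_getVert] at h
  exact exists_dives_of_hasTraversals hδ (dist_meshPoint_getVert_succ_le hδ γ.walk) hρR h

/-- Lattice units: distances from a mesh point scale by `δ` (`meshPoint δ u = δ · u`), so the dives /
in-bridges above, read at the centre `x / δ` and radii `(ρ + δ)/δ = ρ/δ + 1`, `(R − δ)/δ = R/δ − 1`, are
exactly the lattice-unit annular in-bridges of `AnnularMassDecay`. [folklore] -/
theorem dist_meshPoint_eq_mul (hδ : 0 < δ) (w : Site 2) (x : ℂ) :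
    dist (meshPoint δ w) x = δ * dist (Site.toComplex w) (x / δ) := by
  have hδ' : (δ : ℂ) ≠ 0 := by exact_mod_cast hδ.ne'
  have : x = (δ : ℂ) * (x / δ) := by field_simp
  conv_lhs => rw [this, meshPoint]
  rw [dist_eq_norm, dist_eq_norm, ← mul_sub, norm_mul, Complex.norm_real, Real.norm_eq_abs,
    abs_of_pos hδ]

/-! ### Sub-walks as elements of `SAW.Zd.saws`; the conversion in lattice units -/

/-- The sub-walk `γ(a), …, γ(a + n)` (`a + n ≤ |γ|`) of a self-avoiding walk of `Ω_δ`, translated to start at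
the origin and frozen after `n` steps, is an `n`-step self-avoiding walk of `ℤ²` in the sense of
`SAW.Zd.saws`. [folklore] -/
theorem subwalk_mem_saws (γ : SAW.DomainSAW Ω δ u v) {a n : ℕ} (han : a + n ≤ γ.length) :
    (fun i => γ.walk.getVert (a + min i n) - γ.walk.getVert a) ∈ SAW.Zd.saws 2 n := by
  rw [SAW.Zd.mem_saws]
  refine ⟨by simp, fun i hi => by simp [min_eq_right hi], fun i hi => ?_, ?_⟩
  · rw [SAW.Zd.zdGraph_adj_sub_right, min_eq_left hi.le, min_eq_left (by omega : i + 1 ≤ n), ← add_assoc]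
    have hlt : a + i < γ.walk.length := by
      have : γ.length = γ.walk.length := rfl
      omega
    exact meshGraph_le_zdGraph Ω δ (discreteDomainGraph_le_meshGraph Ω δ (γ.walk.adj_getVert_succ hlt))
  · intro i hi j hj hij
    simp only [Set.mem_setOf_eq] at hi hj
    have hinj := γ.isPath.getVert_injOn
    have h' : γ.walk.getVert (a + i) = γ.walk.getVert (a + j) := by
      have := hij
      simp only [min_eq_left hi, min_eq_left hj] at this
      exact sub_left_injective this
    have hlen : γ.length = γ.walk.length := rfl
    have := hinj (by simp only [Set.mem_setOf_eq]; omega) (by simp only [Set.mem_setOf_eq]; omega) h'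
    omega

/-- **Traversals of the SAW polyline give disjoint annular in-bridges of the lattice walk, in the vocabulary
of `AnnularMassDecay`.**  If the mesh-`δ` polyline of a self-avoiding walk `γ` of `Ω_δ` (`δ > 0`) has `2j`
separate traversals of `D(x; ρ, R)` with `ρ + δ < R − δ`, then there are `j` index intervals
`[aₘ, aₘ + nₘ]`, pairwise disjoint and increasing, such that the translated sub-walk
`ω = γ(aₘ + ·) − γ(aₘ) ∈ SAW.Zd.saws 2 nₘ` started at `u = γ(aₘ)` satisfies, about the centre `z = x/δ` with
the lattice radii `r = (ρ + δ)/δ` and `R' = (R − δ)/δ`: `R' ≤ dist u z`, every interior vertex `u + ω i`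
(`0 < i < nₘ`) lies in the open annulus `r < dist · z < R'`, and the last vertex `u + ω nₘ` has
`dist · z ≤ r` — literally the filter of `AnnularMassDecay` (whose remaining hypotheses `1 ≤ r`, `r < R'` hold
as soon as `0 < δ` and `ρ + δ < R − δ`). [folklore] -/
theorem exists_annularBridges_of_hasTraversals (hδ : 0 < δ) (γ : SAW.DomainSAW Ω δ u v) {x : ℂ}
    {ρ R : ℝ} (hρR : ρ + δ < R - δ) {j : ℕ}
    (h : (⟨γ.walk.toCurve (meshPoint δ)⟩ : Curve ℂ).HasTraversals (2 * j) x ρ R) :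
    ∃ a n : Fin j → ℕ, (∀ m, 0 < n m) ∧ (∀ m, a m + n m ≤ γ.length) ∧
      (∀ ⦃m m' : Fin j⦄, m < m' → a m + n m < a m') ∧
      ∀ m, (fun i => γ.walk.getVert (a m + min i (n m)) - γ.walk.getVert (a m)) ∈ SAW.Zd.saws 2 (n m) ∧
        (R - δ) / δ ≤ dist (Site.toComplex (γ.walk.getVert (a m))) (x / δ) ∧
        (∀ i, 0 < i → i < n m →
          (ρ + δ) / δ < dist (Site.toComplex (γ.walk.getVert (a m) +
            (γ.walk.getVert (a m + min i (n m)) - γ.walk.getVert (a m)))) (x / δ) ∧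
          dist (Site.toComplex (γ.walk.getVert (a m) +
            (γ.walk.getVert (a m + min i (n m)) - γ.walk.getVert (a m)))) (x / δ) < (R - δ) / δ) ∧
        dist (Site.toComplex (γ.walk.getVert (a m) +
          (γ.walk.getVert (a m + min (n m) (n m)) - γ.walk.getVert (a m)))) (x / δ) ≤ (ρ + δ) / δ := by
  obtain ⟨a, b, hab, hbn, hsep, hout, hin⟩ := exists_dives_of_hasTraversals_toCurve hδ.le γ hρR h
  -- refine every dive to an in-bridge
  have key : ∀ m : Fin j, ∃ a' b', a m ≤ a' ∧ a' < b' ∧ b' ≤ b m ∧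
      R - δ ≤ dist (meshPoint δ (γ.walk.getVert a')) x ∧ dist (meshPoint δ (γ.walk.getVert b')) x ≤ ρ + δ ∧
      ∀ i, a' < i → i < b' → ρ + δ < dist (meshPoint δ (γ.walk.getVert i)) x ∧
        dist (meshPoint δ (γ.walk.getVert i)) x < R - δ :=
    fun m => exists_inBridge_of_dive (p := fun i => meshPoint δ (γ.walk.getVert i)) hρR (hab m).le
      (hout m) (hin m)
  choose a' b' haa' ha'b' hb'b hout' hin' hint using key
  -- lattice units: divide every radial inequality by `δ`
  have hunit : ∀ w : Site 2, dist (Site.toComplex w) (x / δ) = dist (meshPoint δ w) x / δ := fun w => by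
    rw [dist_meshPoint_eq_mul hδ, mul_div_cancel_left₀ _ hδ.ne']
  refine ⟨a', fun m => b' m - a' m, ?_, ?_, ?_, ?_⟩
  · intro m; dsimp only; have := ha'b' m; omega
  · intro m; dsimp only; have := hbn m; have := hb'b m; have := ha'b' m; omega
  · intro m m' hmm'; dsimp only; have := hsep hmm'; have := hb'b m; have := haa' m'; have := ha'b' m; omega
  · intro m
    dsimp only
    refine ⟨subwalk_mem_saws γ ?_, ?_, fun i hi0 hi => ?_, ?_⟩
    · have := hbn m; have := hb'b m; have := ha'b' m; omega
    · rw [hunit]; exact div_le_div_of_nonneg_right (hout' m) hδ.le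
    · have hi' : a' m + min i (b' m - a' m) = a' m + i := by rw [min_eq_left hi.le]
      rw [add_sub_cancel, hi', hunit]
      obtain ⟨h1, h2⟩ := hint m (a' m + i) (by omega) (by omega)
      exact ⟨div_lt_div_of_pos_right h1 hδ, div_lt_div_of_pos_right h2 hδ⟩
    · have hn : a' m + min (b' m - a' m) (b' m - a' m) = b' m := by
        rw [min_self]; have := ha'b' m; omega
      rw [add_sub_cancel, hn, hunit]
      exact div_le_div_of_nonneg_right (hin' m) hδ.le

end SAW

end Summit.CriticalPhenomena.SAWScalingLimit.Theorems.SurgeryReduction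

end
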